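import Summits.BirchSwinnertonDyer.BirchSwinnertonDyer.Theorems.ByReductionTypeAtTwoRankOneAtTwoBigImageOddLocalOneDoorSubsliceFirstLayer
import Summits.BirchSwinnertonDyer.BirchSwinnertonDyer.Theorems.ByReductionTypeAtTwoRankOneAtTwoBigImageOddLocalOneDoorSubsliceFirstLayerCone
import Summits.BirchSwinnertonDyer.BirchSwinnertonDyer.Theorems.ByReductionTypeAtTwoRankOneAtTwoBigImageOddLocalOneDoorEggKappaDictionary
import Literature.NumberTheory.EllipticCurves.ModularityVersionApProofs
import HarnessLib

/-!
# Route ByReductionTypeAtTwo, crux `RankOneAtTwoBigImageOddLocal` (stmt-BirchSwinnertonDyer-23715), LINE v8.17 `one_door_analytic`: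
# W1/W2 of lead report G16 §4 — the first-layer stub R₀⁺ / R₀ read in the cell's lens laws: AN-22K `TranspositionDoorLawAtTwo` (its Kolyvagin
# direction) at `Δ_W < 0` and AN-13′ `HeegnerKummerClassNonzeroAtTwo` at `Δ_W > 0`, on the slice, modulo print

Width prover seat `bsd-line-fkl-p2` g14 (2026-08-29), `--supports stmt-BirchSwinnertonDyer-23715` (helper).  THEOREMS ONLY; CONDITIONAL by design (R₀⁺ / R₀ /
R⁻₀ / AN-22K / AN-13 are hypotheses where named); BSD is not proved by any of this.  The lead's `…FirstLayer.lean` (R₀ ⟹ R⁻₀) and `…FirstLayerCone.lean`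
(R⁻₀ ∧ AN-13 ⟹ R₀) relate the v8.16/v8.17 first-layer stubs to each other; this file relates them to the -an lens laws BY NAME:
* §1 `(d, N_W) = 1` at desc- / transposition-admissible doors (every prime of `d` is a prime of good reduction; `dvd_conductorNorm_iff_not_hasGoodReductionAtPrime`)
  — discharges R⁻₀'s / R₀'s coprimality binder at the lens doors.
* §2 (W2) `Δ_W < 0`: R⁻₀ `HeegnerNonDivisibilityAtSelmerTrivialPrimeDoorAtTwo` ⟹ the KOLYVAGIN DIRECTION of AN-22K on the slice (`MeetsNonNormAt W q₀ ⟹ y_K ∉ 2E(K) +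
  E(K)_tors` at every transposition-admissible door with odd constant; the `Sel₂`-triviality R⁻₀ asks for is FORCED by the open door — route GenusKolyvaginAtTwo's
  PROVED transposition twist law), and conversely AN-22K ⟹ R⁻₀ (only its Kolyvagin direction is used); so R⁻₀ ⟺ AN-22K(⟸) on the slice modulo Gross–Zagier,
  Kolyvagin, modularity, Hoffstein–Luo (for `rank E(ℚ) = 1`).  AN-22K's other direction (norm branch ⟹ `y_K` twice) is BSD₂-grade (R_S territory) and not part of R₀.
* §3 (W1, Kummer-class form) `Δ_W > 0`: R₀ ⟹ AN-13′ `HeegnerKummerClassNonzeroAtTwo` on the slice (at a desc-admissible door of an egg-meeting curve `#Sel₂(W^{(d)}) = 1`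
  is FORCED by the PROVED egg twist law, the door is minimal, coprime (§1), Heegner); hence R₀⁺ ⟹ AN-13′|slice.  The archimedean form AN-13 (`EggUpToTorsion`) needs in
  addition «`E(K) = E(ℚ) + E(K)_tors` at a rank-`0`-twin door» to apply AN-34n's rational-point dictionary (`rationalPointEggKappaIndexDictionaryAtTwo`) — left as
  `-- TODO(W1, archimedean form)`.

References: [GrossLMS1991] Conj. 1.2, §3, §10; [MazurRubin2010] Prop. 3.3, Cor. 3.4 (i); [Kramer1981] Prop. 3, Prop. 6; [Zhang2014CJM] Thm. 1.1 (shape);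
[DiamondShurman2005] §8.3.
-/

set_option autoImplicit false
-- the Theorems namespace of this sub repeats the summit name by design (D-0017 nested layout)
set_option linter.dupNamespace false

noncomputable section

open scoped Classical

namespace Summit.BirchSwinnertonDyer.BirchSwinnertonDyer.Theorems.RankOneAtTwoOneDoor

open WeierstrassCurve NumberField Literature.NumberTheory.EllipticCurves Literature.NumberTheory.EllipticCurves.ModularForms
  Summit.BirchSwinnertonDyer.Rank1Residual.F1Sign2
  Summit.BirchSwinnertonDyer.Rank1Residual.F1Sign2.TranspositionDoor
  Summit.BirchSwinnertonDyer.BirchSwinnertonDyer.Theses.ByReductionTypeAtTwo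
open Summit.BirchSwinnertonDyer.BirchSwinnertonDyer.Theorems.GenusKolyArch (eggTwistLawAtTwo_holds)
open Summit.BirchSwinnertonDyer.BirchSwinnertonDyer.Theorems.GenusKolyTransp (transpositionTwistLawAtTwo_holds)

/-! ### §1 Lens doors are coprime to the conductor -/

/-- If every prime of `d` is a prime of good reduction then `(|d|, N_W) = 1` (`p ∣ N_W ⟺` bad reduction at `p`). [cite: DiamondShurman2005, §8.3] -/
theorem coprime_natAbs_conductorNorm_of_good (W : WeierstrassCurve ℚ) [W.IsElliptic] {d : ℤ}
    (hgood : ∀ q : ℕ, q.Prime → (q : ℤ) ∣ d → ∀ _h : Fact q.Prime, W.HasGoodReductionAtPrime q) :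
    Nat.Coprime d.natAbs (W.conductorNorm ℤ) := by
  refine Nat.coprime_of_dvd fun k hk hkd hkN => ?_
  haveI : Fact k.Prime := ⟨hk⟩
  have hkd' : (k : ℤ) ∣ d := Int.ofNat_dvd_left.mpr hkd
  exact ((W.dvd_conductorNorm_iff_not_hasGoodReductionAtPrime k).mp hkN) (hgood k hk hkd' ⟨hk⟩)

/-- **A desc-admissible `d` is coprime to `N_W`.** [cite: Kramer1981, Prop. 6] [cite: DiamondShurman2005, §8.3] -/
theorem coprime_natAbs_conductorNorm_of_descAdmissible (W : WeierstrassCurve ℚ) [W.IsElliptic] [W.IsGloballyMinimal] {d : ℤ}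
    (hd : DescAdmissible W d) : Nat.Coprime d.natAbs (W.conductorNorm ℤ) := by
  obtain ⟨-, -, -, hprimes, -⟩ := hd
  exact coprime_natAbs_conductorNorm_of_good W fun q hq hqd h => (hprimes q hq hqd).1 h

/-- **A transposition-admissible `d` is coprime to `N_W`.** [cite: MazurRubin2010, Prop. 3.3] [cite: DiamondShurman2005, §8.3] -/
theorem coprime_natAbs_conductorNorm_of_transpAdmissible (W : WeierstrassCurve ℚ) [W.IsElliptic] [W.IsGloballyMinimal] {d : ℤ} {q₀ : ℕ}
    (hd : TranspAdmissible W d q₀) : Nat.Coprime d.natAbs (W.conductorNorm ℤ) := by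
  obtain ⟨-, -, -, -, -, -, hprimes, -⟩ := hd
  exact coprime_natAbs_conductorNorm_of_good W fun q hq hqd h => (hprimes q hq hqd).1 h

/-! ### §2 (W2) `Δ_W < 0`: R⁻₀ versus AN-22K's Kolyvagin direction -/

/-- **W2 (⟹): R⁻₀ GIVES AN-22K's KOLYVAGIN DIRECTION ON THE SLICE.**  Granting R⁻₀ `HeegnerNonDivisibilityAtSelmerTrivialPrimeDoorAtTwo` (hypothesis) and print
(Gross–Zagier, Kolyvagin, modularity, Hoffstein–Luo — for `rank E(ℚ) = 1`): for `W` on the slice (non-CM, `ρ_{W,2^n}` onto, odd torsion, odd Tamagawa, analytic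
rank `1`) with `Δ_W < 0`, `Ш(W)[2] = 0`, at every transposition-admissible door `(d_K, q₀)` with an odd-constant datum, `MeetsNonNormAt W q₀ ⟹ y_K ∉ 2E(K) + E(K)_tors`.
The `Sel₂`-triviality, coprimality and Heegner binders of R⁻₀ are discharged (transposition twist law `(… ).1`, §1, `satisfiesHeegnerHypothesis_of_doorAdmissible`).
CONDITIONAL by design. [cite: MazurRubin2010, Prop. 3.3 and Cor. 3.4 (i)] [cite: GrossLMS1991, Conj. 1.2 and §3] -/
theorem transpositionDoorLaw_kolyvagin_onSlice_of_heegnerNonDivPrimeDoor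
    (hGZ : ∀ (N : ℕ) [NeZero N] (W : WeierstrassCurve ℚ) (K : Type) [Field K] [NumberField K], gross_zagier N W K)
    (hKo : ∀ (N : ℕ) [NeZero N] (W : WeierstrassCurve ℚ) (K : Type) [Field K] [NumberField K], kolyvagin N W K)
    (hnf : exists_isNewformOf) (hHL : HoffsteinLuo1997_exists_twist_L_one_ne_zero) (hR : HeegnerNonDivisibilityAtSelmerTrivialPrimeDoorAtTwo)
    (W : WeierstrassCurve ℚ) [W.IsElliptic] [W.IsGloballyMinimal] [NeZero (W.conductorNorm ℤ)]
    (hCM : ¬ W.HasCM) (hsurj : ∀ n : ℕ, W.HasSurjectiveModNGaloisRep ((2 ^ n : ℕ) : ℤ)) (hT : Odd W.torsionOrder) (hc : Odd W.tamagawaProduct)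
    (hr : W.analyticRank = 1) (hΔ : W.Δ < 0) (hSha : ShaTwoTrivial W)
    (K : Type) [Field K] [NumberField K] (hK : IsImaginaryQuadratic K) (q₀ : ℕ) [Fact q₀.Prime]
    (htr : TranspAdmissible W (NumberField.discr K) q₀)
    (Dt : ModularParametrizationData W (W.conductorNorm ℤ)) (H : HeegnerDatum (W.conductorNorm ℤ) (NumberField.discr K)) (ι : K →+* ℂ)
    (P : (W.baseChange K).toAffine.Point) (hP : WeierstrassCurve.Affine.Point.map ι.toRatAlgHom P = heegnerPointComplex Dt H) (hodd : Odd Dt.c)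
    (hnn : MeetsNonNormAt W q₀) : NotTwiceUpToTorsion W K P := by
  have hT2 : NoRationalTwoTorsion W := noRationalTwoTorsion_of_odd_torsionOrder W hT
  have hrk : W.mordellWeilRank = 1 := (mordellWeilRank_eq_one_of_analyticRank_eq_one_of_isGloballyMinimal hGZ hKo hnf hHL W hr).1
  have hsel : twistSelmerTwoCard W (NumberField.discr K) = 1 := (transpositionTwistLawAtTwo_holds W hΔ hT2 hrk hSha _ q₀ htr).1 hnn
  have hcop : Nat.Coprime (NumberField.discr K).natAbs (W.conductorNorm ℤ) := coprime_natAbs_conductorNorm_of_transpAdmissible W htr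
  have hHN : SatisfiesHeegnerHypothesis (W.conductorNorm ℤ) K :=
    satisfiesHeegnerHypothesis_of_doorAdmissible W K hK (ANg16.doorAdmissible_of_transpAdmissible W htr)
  exact notTwiceUpToTorsion_of_hasTwoDivisibilityUpToTorsion_zero W K P
    (hR W hCM hsurj hT hc hr hΔ hSha K hK q₀ htr hnn hcop hHN hsel Dt H ι P hP hodd)

/-- **W2 (⟸): AN-22K `TranspositionDoorLawAtTwo` GIVES R⁻₀** (only its Kolyvagin direction `MeetsNonNormAt ⟹ NotTwiceUpToTorsion` is used), modulo print for
`rank E(ℚ) = 1`.  CONDITIONAL by design. [cite: GrossLMS1991, Conj. 1.2 and §3] [cite: MazurRubin2010, Prop. 3.3] -/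
theorem heegnerNonDivPrimeDoor_of_transpositionDoorLaw
    (hGZ : ∀ (N : ℕ) [NeZero N] (W : WeierstrassCurve ℚ) (K : Type) [Field K] [NumberField K], gross_zagier N W K)
    (hKo : ∀ (N : ℕ) [NeZero N] (W : WeierstrassCurve ℚ) (K : Type) [Field K] [NumberField K], kolyvagin N W K)
    (hnf : exists_isNewformOf) (hHL : HoffsteinLuo1997_exists_twist_L_one_ne_zero) (hL : TranspositionDoorLawAtTwo) :
    HeegnerNonDivisibilityAtSelmerTrivialPrimeDoorAtTwo := by
  intro W _ _ _ hCM hsurj hT hc hr hΔ hSha K _ _ hK q₀ _ htr hnn hcop hHN hsel Dt H ι P hP hodd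
  have hT2 : NoRationalTwoTorsion W := noRationalTwoTorsion_of_odd_torsionOrder W hT
  have hrk : W.mordellWeilRank = 1 := (mordellWeilRank_eq_one_of_analyticRank_eq_one_of_isGloballyMinimal hGZ hKo hnf hHL W hr).1
  have hc2 : ¬ 2 ∣ W.tamagawaProduct := fun h => (Nat.not_even_iff_odd.mpr hc) (even_iff_two_dvd.mpr h)
  have hcodd : ¬ (2 : ℤ) ∣ Dt.c := fun h => (Int.not_even_iff_odd.mpr hodd) (even_iff_two_dvd.mpr h)
  exact hasTwoDivisibilityUpToTorsion_zero_of_notTwiceUpToTorsion W K P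
    ((hL W hrk hΔ hT2 hSha hc2 q₀ K hK htr Dt H ι P hP hcodd).mpr hnn)

/-- **R₀ (hence R₀⁺) GIVES AN-22K's KOLYVAGIN DIRECTION ON THE SLICE** (compose with the lead's R₀ ⟹ R⁻₀, `heegnerNonDivisibilityAtSelmerTrivialPrimeDoorAtTwo_of_minimalDoor`,
and R₀⁺ ⟹ R₀, `heegnerNonDivisibilityMinimalDoor_of_heegnerExponent`).  CONDITIONAL by design. [cite: Zhang2014CJM, Thm. 1.1 (shape)] [cite: MazurRubin2010, Cor. 3.4 (i)] -/
theorem transpositionDoorLaw_kolyvagin_onSlice_of_heegnerExponent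
    (hGZ : ∀ (N : ℕ) [NeZero N] (W : WeierstrassCurve ℚ) (K : Type) [Field K] [NumberField K], gross_zagier N W K)
    (hKo : ∀ (N : ℕ) [NeZero N] (W : WeierstrassCurve ℚ) (K : Type) [Field K] [NumberField K], kolyvagin N W K)
    (hnf : exists_isNewformOf) (hHL : HoffsteinLuo1997_exists_twist_L_one_ne_zero) (h : HeegnerExponentAtSelmerTrivialMinimalDoorAtTwo)
    (W : WeierstrassCurve ℚ) [W.IsElliptic] [W.IsGloballyMinimal] [NeZero (W.conductorNorm ℤ)]
    (hCM : ¬ W.HasCM) (hsurj : ∀ n : ℕ, W.HasSurjectiveModNGaloisRep ((2 ^ n : ℕ) : ℤ)) (hT : Odd W.torsionOrder) (hc : Odd W.tamagawaProduct)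
    (hr : W.analyticRank = 1) (hΔ : W.Δ < 0) (hSha : ShaTwoTrivial W)
    (K : Type) [Field K] [NumberField K] (hK : IsImaginaryQuadratic K) (q₀ : ℕ) [Fact q₀.Prime]
    (htr : TranspAdmissible W (NumberField.discr K) q₀)
    (Dt : ModularParametrizationData W (W.conductorNorm ℤ)) (H : HeegnerDatum (W.conductorNorm ℤ) (NumberField.discr K)) (ι : K →+* ℂ)
    (P : (W.baseChange K).toAffine.Point) (hP : WeierstrassCurve.Affine.Point.map ι.toRatAlgHom P = heegnerPointComplex Dt H) (hodd : Odd Dt.c)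
    (hnn : MeetsNonNormAt W q₀) : NotTwiceUpToTorsion W K P :=
  transpositionDoorLaw_kolyvagin_onSlice_of_heegnerNonDivPrimeDoor hGZ hKo hnf hHL
    (heegnerNonDivisibilityAtSelmerTrivialPrimeDoorAtTwo_of_minimalDoor (heegnerNonDivisibilityMinimalDoor_of_heegnerExponent h))
    W hCM hsurj hT hc hr hΔ hSha K hK q₀ htr Dt H ι P hP hodd hnn

/-- **THE LENS PAIR GIVES R₀**: AN-22K (its Kolyvagin direction, via `heegnerNonDivPrimeDoor_of_transpositionDoorLaw`) and AN-13 give the sign-free odd-constant first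
layer R₀ `HeegnerNonDivisibilityAtSelmerTrivialMinimalDoorAtTwo` — the lead's cone theorem `kolyvaginTwo_of_heegnerNonDiv_of_heegnerPointOnEgg` with R⁻₀ discharged
to AN-22K.  CONDITIONAL by design. [cite: Zhang2014CJM, Thm. 1.1 (shape)] [cite: Kramer1981, Prop. 3 and Prop. 6] [cite: MazurRubin2010, Cor. 3.4 (i)] -/
theorem kolyvaginTwo_of_transpositionDoorLaw_of_heegnerPointOnEgg
    (hGZ : ∀ (N : ℕ) [NeZero N] (W : WeierstrassCurve ℚ) (K : Type) [Field K] [NumberField K], gross_zagier N W K)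
    (hKo : ∀ (N : ℕ) [NeZero N] (W : WeierstrassCurve ℚ) (K : Type) [Field K] [NumberField K], kolyvagin N W K)
    (hnf : exists_isNewformOf) (hHL : HoffsteinLuo1997_exists_twist_L_one_ne_zero) (hL : TranspositionDoorLawAtTwo) (h13 : HeegnerPointOnEggAtTwo) :
    HeegnerNonDivisibilityAtSelmerTrivialMinimalDoorAtTwo :=
  kolyvaginTwo_of_heegnerNonDiv_of_heegnerPointOnEgg hGZ hKo hnf hHL (heegnerNonDivPrimeDoor_of_transpositionDoorLaw hGZ hKo hnf hHL hL) h13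

/-! ### §3 (W1, Kummer-class form) `Δ_W > 0`: R₀ versus AN-13′ -/

/-- **W1 (Kummer-class form): R₀ GIVES AN-13′ `HeegnerKummerClassNonzeroAtTwo` ON THE SLICE.**  Granting R₀ `HeegnerNonDivisibilityAtSelmerTrivialMinimalDoorAtTwo` and
print (for `rank E(ℚ) = 1`): for `W` on the slice with `Δ_W > 0`, `Ш(W)[2] = 0`, `E(ℚ)` meeting the egg, at every desc-admissible door with an odd-constant datum,
`y_K ∉ 2E(K) + E(K)_tors`.  R₀'s door binders are discharged: door-admissible (`ANg16.doorAdmissible_of_descAdmissible`), minimal (`minimal_of_descAdmissible_of_pos`),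
coprime (§1), Heegner (`satisfiesHeegnerHypothesis_of_doorAdmissible`), `#Sel₂(W^{(d)}) = 1` (PROVED egg twist law).  CONDITIONAL by design.
-- TODO(W1, archimedean form): AN-13 `HeegnerPointOnEggAtTwo` itself (`EggUpToTorsion`) needs `y_K ∈ E(ℚ) + E(K)_tors` at a rank-`0`-twin door to apply AN-34n.
[cite: Zhang2014CJM, Thm. 1.1 (shape)] [cite: Kramer1981, Prop. 6] [cite: GrossLMS1991, Conj. 1.2 and §3] -/
theorem heegnerKummerClassNonzero_onSlice_of_kolyvaginTwo
    (hGZ : ∀ (N : ℕ) [NeZero N] (W : WeierstrassCurve ℚ) (K : Type) [Field K] [NumberField K], gross_zagier N W K)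
    (hKo : ∀ (N : ℕ) [NeZero N] (W : WeierstrassCurve ℚ) (K : Type) [Field K] [NumberField K], kolyvagin N W K)
    (hnf : exists_isNewformOf) (hHL : HoffsteinLuo1997_exists_twist_L_one_ne_zero) (h : HeegnerNonDivisibilityAtSelmerTrivialMinimalDoorAtTwo)
    (W : WeierstrassCurve ℚ) [W.IsElliptic] [W.IsGloballyMinimal] [NeZero (W.conductorNorm ℤ)]
    (hCM : ¬ W.HasCM) (hsurj : ∀ n : ℕ, W.HasSurjectiveModNGaloisRep ((2 ^ n : ℕ) : ℤ)) (hT : Odd W.torsionOrder) (hc : Odd W.tamagawaProduct)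
    (hr : W.analyticRank = 1) (hΔ : 0 < W.Δ) (hSha : ShaTwoTrivial W) (hmeets : MeetsEgg W)
    (K : Type) [Field K] [NumberField K] (hK : IsImaginaryQuadratic K) (hDA : DescAdmissible W (NumberField.discr K))
    (Dt : ModularParametrizationData W (W.conductorNorm ℤ)) (H : HeegnerDatum (W.conductorNorm ℤ) (NumberField.discr K)) (ι : K →+* ℂ)
    (P : (W.baseChange K).toAffine.Point) (hP : WeierstrassCurve.Affine.Point.map ι.toRatAlgHom P = heegnerPointComplex Dt H) (hodd : Odd Dt.c) :
    NotTwiceUpToTorsion W K P := by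
  have hT2 : NoRationalTwoTorsion W := noRationalTwoTorsion_of_odd_torsionOrder W hT
  have hrk : W.mordellWeilRank = 1 := (mordellWeilRank_eq_one_of_analyticRank_eq_one_of_isGloballyMinimal hGZ hKo hnf hHL W hr).1
  have hsel : twistSelmerTwoCard W (NumberField.discr K) = 1 := (eggTwistLawAtTwo_holds W hΔ hT2 hrk hSha _ hDA).1 hmeets
  have hcop : Nat.Coprime (NumberField.discr K).natAbs (W.conductorNorm ℤ) := coprime_natAbs_conductorNorm_of_descAdmissible W hDA
  have hadm : DoorAdmissible W (NumberField.discr K) := ANg16.doorAdmissible_of_descAdmissible W hDA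
  have hHN : SatisfiesHeegnerHypothesis (W.conductorNorm ℤ) K := satisfiesHeegnerHypothesis_of_doorAdmissible W K hK hadm
  exact notTwiceUpToTorsion_of_hasTwoDivisibilityUpToTorsion_zero W K P
    (h W hCM hsurj hT hc hr hSha K hK hadm (minimal_of_descAdmissible_of_pos W hΔ hDA) hcop hHN hsel Dt H ι P hP hodd)

/-- **R₀⁺ GIVES AN-13′ ON THE SLICE** (through R₀⁺ ⟹ R₀).  CONDITIONAL by design. [cite: Zhang2014CJM, Thm. 1.1 (shape)] [cite: Kramer1981, Prop. 6] -/
theorem heegnerKummerClassNonzero_onSlice_of_heegnerExponent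
    (hGZ : ∀ (N : ℕ) [NeZero N] (W : WeierstrassCurve ℚ) (K : Type) [Field K] [NumberField K], gross_zagier N W K)
    (hKo : ∀ (N : ℕ) [NeZero N] (W : WeierstrassCurve ℚ) (K : Type) [Field K] [NumberField K], kolyvagin N W K)
    (hnf : exists_isNewformOf) (hHL : HoffsteinLuo1997_exists_twist_L_one_ne_zero) (h : HeegnerExponentAtSelmerTrivialMinimalDoorAtTwo)
    (W : WeierstrassCurve ℚ) [W.IsElliptic] [W.IsGloballyMinimal] [NeZero (W.conductorNorm ℤ)]
    (hCM : ¬ W.HasCM) (hsurj : ∀ n : ℕ, W.HasSurjectiveModNGaloisRep ((2 ^ n : ℕ) : ℤ)) (hT : Odd W.torsionOrder) (hc : Odd W.tamagawaProduct)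
    (hr : W.analyticRank = 1) (hΔ : 0 < W.Δ) (hSha : ShaTwoTrivial W) (hmeets : MeetsEgg W)
    (K : Type) [Field K] [NumberField K] (hK : IsImaginaryQuadratic K) (hDA : DescAdmissible W (NumberField.discr K))
    (Dt : ModularParametrizationData W (W.conductorNorm ℤ)) (H : HeegnerDatum (W.conductorNorm ℤ) (NumberField.discr K)) (ι : K →+* ℂ)
    (P : (W.baseChange K).toAffine.Point) (hP : WeierstrassCurve.Affine.Point.map ι.toRatAlgHom P = heegnerPointComplex Dt H) (hodd : Odd Dt.c) :
    NotTwiceUpToTorsion W K P :=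
  heegnerKummerClassNonzero_onSlice_of_kolyvaginTwo hGZ hKo hnf hHL (heegnerNonDivisibilityMinimalDoor_of_heegnerExponent h) W hCM hsurj hT hc hr hΔ hSha
    hmeets K hK hDA Dt H ι P hP hodd

/-- **Conversely, AN-13′ restricted to the slice's egg doors GIVES R₀'s `Δ_W > 0` FACE** (the Kummer-class form of the lead's cone theorem: no egg geometry needed —
at a door-admissible minimal `Sel₂`-trivial door with `Δ_W > 0` the door is desc-admissible and `E(ℚ)` meets the egg).  Stated with AN-13′ as a hypothesis BY NAME
(`HeegnerKummerClassNonzeroAtTwo` carries `rank E(ℚ) = 1`, supplied by print).  CONDITIONAL by design. [cite: Kramer1981, Prop. 6] [cite: Zhang2014CJM, Thm. 1.1 (shape)] -/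
theorem kolyvaginTwo_posDisc_of_heegnerKummerClassNonzero
    (hGZ : ∀ (N : ℕ) [NeZero N] (W : WeierstrassCurve ℚ) (K : Type) [Field K] [NumberField K], gross_zagier N W K)
    (hKo : ∀ (N : ℕ) [NeZero N] (W : WeierstrassCurve ℚ) (K : Type) [Field K] [NumberField K], kolyvagin N W K)
    (hnf : exists_isNewformOf) (hHL : HoffsteinLuo1997_exists_twist_L_one_ne_zero) (h13 : HeegnerKummerClassNonzeroAtTwo)
    (W : WeierstrassCurve ℚ) [W.IsElliptic] [W.IsGloballyMinimal] [NeZero (W.conductorNorm ℤ)]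
    (hT : Odd W.torsionOrder) (hc : Odd W.tamagawaProduct) (hr : W.analyticRank = 1) (hΔ : 0 < W.Δ) (hSha : ShaTwoTrivial W)
    (K : Type) [Field K] [NumberField K] (hK : IsImaginaryQuadratic K) (hadm : DoorAdmissible W (NumberField.discr K))
    (hmin : transpCount W (NumberField.discr K) + 2 * identCount W (NumberField.discr K) = (if W.Δ < 0 then 1 else 0))
    (hsel : twistSelmerTwoCard W (NumberField.discr K) = 1)
    (Dt : ModularParametrizationData W (W.conductorNorm ℤ)) (H : HeegnerDatum (W.conductorNorm ℤ) (NumberField.discr K)) (ι : K →+* ℂ)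
    (P : (W.baseChange K).toAffine.Point) (hP : WeierstrassCurve.Affine.Point.map ι.toRatAlgHom P = heegnerPointComplex Dt H) (hodd : Odd Dt.c) :
    HasTwoDivisibilityUpToTorsion W K P 0 := by
  have hT2 : NoRationalTwoTorsion W := noRationalTwoTorsion_of_odd_torsionOrder W hT
  have hrk : W.mordellWeilRank = 1 := (mordellWeilRank_eq_one_of_analyticRank_eq_one_of_isGloballyMinimal hGZ hKo hnf hHL W hr).1
  rw [if_neg (not_lt.mpr hΔ.le)] at hmin
  have ht : transpCount W (NumberField.discr K) = 0 := by omega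
  have hs : identCount W (NumberField.discr K) = 0 := by omega
  have hDA : DescAdmissible W (NumberField.discr K) := descAdmissible_of_doorAdmissible_of_counts_eq_zero W hadm ht hs
  have hmeets : MeetsEgg W := meetsEgg_of_twistSelmerTwoCard_eq_one W hΔ hT2 hrk hSha hDA hsel
  have hc2 : ¬ 2 ∣ W.tamagawaProduct := fun h => (Nat.not_even_iff_odd.mpr hc) (even_iff_two_dvd.mpr h)
  have hcodd : ¬ (2 : ℤ) ∣ Dt.c := fun h => (Int.not_even_iff_odd.mpr hodd) (even_iff_two_dvd.mpr h)
  exact hasTwoDivisibilityUpToTorsion_zero_of_notTwiceUpToTorsion W K P (h13 W hΔ hT2 hrk hSha hmeets hc2 K hK hDA Dt H ι P hP hcodd)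

end Summit.BirchSwinnertonDyer.BirchSwinnertonDyer.Theorems.RankOneAtTwoOneDoor

end
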